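/-
Origin: expansion seat `planner-pub-hodgecm-mc-axioms-1-g14-0`, handover #W32 2026-08-20T15:53:55Z md5 e680c1f36290 (PKG 2a98833171ee → e680c1f36290; 111 l.; MECHANICAL (iib-R) rewrite v3.1 of the PKG file as it stands (58 token edits; rules R1x1+RX[h₂]x57)) (`HOME/mc/pub-hodgecm-mc-axioms-1-g14/revendor/kit-r55/stage55/HodgeCM/Model/E2InstanceR4.lean`, md5 e680c1f36290, 111 lines);
landed by the gen-22 packager (p-g22) in gate run 55 REPLACES the earlier landed copy of `HodgeCM/Model/E2InstanceR4.lean` (seat copy carried the packager Origin header of an earlier run (stripped)).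
-/
/-
Unit pub-hodgecm-mc-glue-1-g2 (node E = E ASSEMBLER, vacancy (iii)). NEW additive leaf `HodgeCM/Model/E2InstanceR4.lean`
(imports `E2InstanceR3` + theta-3-g2's `SupplyDischarge`). No proof holes; every undischarged input is an explicit binder.
Expected `#print axioms`: {propext, Classical.choice, Quot.sound}.
-/
import Summits.HodgeConjecture.HodgeCM.Model.E2InstanceR3
import Summits.HodgeConjecture.HodgeCM.Model.SupplyDischarge

/-!
# E2 instance, revision 4: C4-supply from CLASS SUPPLY PACKS (junction J-W7a consumed)

`Model.perL_picardCM_r4` = `Model.perL_picardCM_r3` with the binder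
`lines : GoodCtx → [K:ℚ] = 6 → Nonempty (LineSupplyData T V c 0) ∧ Nonempty (LineSupplyData T V c 1)`
(whose records still carry the residual (W-res) as a field) REPLACED by
`classPacks : GoodCtx → [K:ℚ] = 6 → Nonempty (ClassSupplyPack T V c 0) ∧ Nonempty (ClassSupplyPack T V c 1)`
of theta-3-g2's `HodgeCM/Model/SupplyDischarge.lean` (node J-W7a at the class level): a class supply pack has NO
residual field — `ClassSupplyData.residualT` PROVES it (KERNEL) from the class-map datum, the theta-equivariant
families and the definition of `Θ_k` read as an inclusion — and `ClassSupplyPack.toPairSupplyData`,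
`PairSupplyData.toLineSupplyData` (both KERNEL) give back the line supply data `perL_picardCM_r3` consumes.
This is exactly the recipe of `SupplyResidual.open_supply_of_classSupplyPack`, threaded through the E term.

Remaining binders: `hHR`, `h`, `emb`, `hA`, `wm`, `Theta`, `d12`, `d34`, `innerEmb`, `h31`, `hLiu`, `ball`,
`ballFacts`, `classPacks`, `gen12`, `real34`, `occ`.
-/

noncomputable section

open scoped TensorProduct InnerProductSpace

namespace HodgeCM

namespace Model

open HodgeCM.Universe (AdelicThetaCore AdelicThetaCore₀ SideData ThetaModel ModelAxiomsPerL)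
open Literature.AlgebraicGeometry.HodgeTheory
open Literature.NumberTheory.Automorphic.PicardCM
open Literature.NumberTheory.Transcendental (Arapura2012_Cor_15_4_6)
open HodgeCM.CMTypeOps (inflate)
open HodgeCM.Model.SupplyInstance (LineSupplyData)
open HodgeCM.Model.SupplyResidual (ClassSupplyPack)

variable (hHD : exists_isReal_hodgeModel) (hI : hodgePQ_independent_of_hodgeModel)
  (h₁ : BallQuotientUniformised)  (h₃ : CMAbelianVarietyRealised)

/-- **E2 instance, revision 4** (see the module docstring): `perL_picardCM_r3` with the line supply data
produced from class supply packs (`ClassSupplyPack.toPairSupplyData`, `PairSupplyData.toLineSupplyData`). -/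
theorem perL_picardCM_r4 (hHR : BettiUniverse.HodgeRiemann20) (h : Bool)
    (emb : ∀ {L : CMField} {ι₁ : L →+* ℂ} {V : HermSpace3 L ι₁} (Γ : Level V),
      (picardCMUniverse hHD hI h₁ h₃).CohC ((picardCMUniverse hHD hI h₁ h₃).pms L ι₁ V Γ) 2 →ₗ[ℂ]
        (V.latticeModel printFact_unitaryCompact_holds).toQuotientModel.H)
    (hA : Arapura2012_Cor_15_4_6)
    (wm : ∀ {L : CMField} {ι₁ : L →+* ℂ} (V : HermSpace3 L ι₁) (c : SeesawCtx L),
      WeilThetaModel (V.latticeModel printFact_unitaryCompact_holds).toQuotientModel.G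
        (V.latticeModel printFact_unitaryCompact_holds).toQuotientModel.Γ
        (c.D.latticeModelW printFact_unitaryCompact_holds).toQuotientModel.G
        (c.D.latticeModelW printFact_unitaryCompact_holds).toQuotientModel.Γ)
    (Theta : ∀ {L : CMField} {ι₁ : L →+* ℂ} (V : HermSpace3 L ι₁), SeesawCtx L → Fin 4 → ∀ Γ : Level V,
      Set ((picardCMUniverse hHD hI h₁ h₃).CohC ((picardCMUniverse hHD hI h₁ h₃).pms L ι₁ V Γ) 1))
    (d12 d34 : ∀ {L : CMField}, SeesawCtx L → SideData L)
    (innerEmb : ∀ {L : CMField} {ι₁ : L →+* ℂ} (V : HermSpace3 L ι₁) (c : SeesawCtx L),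
      (thetaModelOf hHD hI h₁ h₃ h emb (coverOf hHD hI h₁ h₃ hA) wm Theta d12 d34).GoodCtx ι₁ c → Module.finrank ℚ c.K = 6 →
      (thetaModelOf hHD hI h₁ h₃ h emb (coverOf hHD hI h₁ h₃ hA) wm Theta d12 d34).InnerEmbAt V)
    (h31 : (picardCMUniverse hHD hI h₁ h₃).Fact_cmInflation)
    (hLiu : ∀ {L : CMField} {ι₁ : L →+* ℂ} (V : HermSpace3 L ι₁) (c : SeesawCtx L),
      (thetaModelOf hHD hI h₁ h₃ h emb (coverOf hHD hI h₁ h₃ hA) wm Theta d12 d34).GoodCtx ι₁ c → Module.finrank ℚ c.K = 6 →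
      ∀ (i : Fin 4) (Γ : Level V), ∃ (M : CMField) (k : c.K →+* M) (σ' : M →+* ℂ), σ'.comp k = c.σ ∧
        (thetaModelOf hHD hI h₁ h₃ h emb (coverOf hHD hI h₁ h₃ hA) wm Theta d12 d34).Theta V c i Γ ⊆
          (picardCMUniverse hHD hI h₁ h₃).Uiso Γ M (inflate k (c.Ψ i)) σ')
    (ball : ∀ {L : CMField} {ι₁ : L →+* ℂ} (V : HermSpace3 L ι₁) (c : SeesawCtx L),
      (picardCMUniverse hHD hI h₁ h₃).BallData V c)
    (ballFacts : ∀ {L : CMField} {ι₁ : L →+* ℂ} (V : HermSpace3 L ι₁) (c : SeesawCtx L),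
      (thetaModelOf hHD hI h₁ h₃ h emb (coverOf hHD hI h₁ h₃ hA) wm Theta d12 d34).GoodCtx ι₁ c → Module.finrank ℚ c.K = 6 →
      (thetaModelOf hHD hI h₁ h₃ h emb (coverOf hHD hI h₁ h₃ hA) wm Theta d12 d34).BallFacts V c (ball V c))
    (classPacks : ∀ {L : CMField} {ι₁ : L →+* ℂ} (V : HermSpace3 L ι₁) (c : SeesawCtx L),
      (thetaModelOf hHD hI h₁ h₃ h emb (coverOf hHD hI h₁ h₃ hA) wm Theta d12 d34).GoodCtx ι₁ c → Module.finrank ℚ c.K = 6 →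
      Nonempty (ClassSupplyPack (thetaModelOf hHD hI h₁ h₃ h emb (coverOf hHD hI h₁ h₃ hA) wm Theta d12 d34) V c 0) ∧
        Nonempty (ClassSupplyPack (thetaModelOf hHD hI h₁ h₃ h emb (coverOf hHD hI h₁ h₃ hA) wm Theta d12 d34) V c 1))
    (gen12 : ∀ {L : CMField} {ι₁ : L →+* ℂ} (V : HermSpace3 L ι₁) (c : SeesawCtx L),
      (thetaModelOf hHD hI h₁ h₃ h emb (coverOf hHD hI h₁ h₃ hA) wm Theta d12 d34).GoodCtx ι₁ c → Module.finrank ℚ c.K = 6 →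
      Nonempty ((thetaModelOf hHD hI h₁ h₃ h emb (coverOf hHD hI h₁ h₃ hA) wm Theta d12 d34).Gen12FunBridge V c))
    (real34 : ∀ {L : CMField} {ι₁ : L →+* ℂ} (V : HermSpace3 L ι₁) (c : SeesawCtx L),
      (thetaModelOf hHD hI h₁ h₃ h emb (coverOf hHD hI h₁ h₃ hA) wm Theta d12 d34).GoodCtx ι₁ c → Module.finrank ℚ c.K = 6 →
      Nonempty ((thetaModelOf hHD hI h₁ h₃ h emb (coverOf hHD hI h₁ h₃ hA) wm Theta d12 d34).Real34FunBridge V c))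
    (occ : ∀ {L : CMField} {ι₁ : L →+* ℂ} (V : HermSpace3 L ι₁) (c : SeesawCtx L),
      (thetaModelOf hHD hI h₁ h₃ h emb (coverOf hHD hI h₁ h₃ hA) wm Theta d12 d34).GoodCtx ι₁ c → Module.finrank ℚ c.K = 6 →
      (∀ (Φ : (thetaModelOf hHD hI h₁ h₃ h emb (coverOf hHD hI h₁ h₃ hA) wm Theta d12 d34).SK V c)
          (i : (thetaModelOf hHD hI h₁ h₃ h emb (coverOf hHD hI h₁ h₃ hA) wm Theta d12 d34).SigIdx V c),
          (∃ v ∈ ((thetaModelOf hHD hI h₁ h₃ h emb (coverOf hHD hI h₁ h₃ hA) wm Theta d12 d34).core V c).hatσ i,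
              ((thetaModelOf hHD hI h₁ h₃ h emb (coverOf hHD hI h₁ h₃ hA) wm Theta d12 d34).core V c).TΦ Φ v ≠ 0) →
          ((thetaModelOf hHD hI h₁ h₃ h emb (coverOf hHD hI h₁ h₃ hA) wm Theta d12 d34).t12 V c).wOccurs i) ∧
        (∀ (Φ : (thetaModelOf hHD hI h₁ h₃ h emb (coverOf hHD hI h₁ h₃ hA) wm Theta d12 d34).SK V c)
          (i : (thetaModelOf hHD hI h₁ h₃ h emb (coverOf hHD hI h₁ h₃ hA) wm Theta d12 d34).SigIdx V c),
          (∃ v ∈ ((thetaModelOf hHD hI h₁ h₃ h emb (coverOf hHD hI h₁ h₃ hA) wm Theta d12 d34).core V c).hatσ i,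
              ((thetaModelOf hHD hI h₁ h₃ h emb (coverOf hHD hI h₁ h₃ hA) wm Theta d12 d34).core V c).TΦ Φ v ≠ 0) →
          ((thetaModelOf hHD hI h₁ h₃ h emb (coverOf hHD hI h₁ h₃ hA) wm Theta d12 d34).t34 V c).wOccurs i)) :
    (picardCMUniverse hHD hI h₁ h₃).PerL :=
  perL_picardCM_r3 hHD hI h₁ h₃ hHR h emb hA wm Theta d12 d34 innerEmb h31 hLiu ball ballFacts
    (fun V c hc hK =>
      ⟨(classPacks V c hc hK).1.map fun S => S.toPairSupplyData.toLineSupplyData,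
        (classPacks V c hc hK).2.map fun S => S.toPairSupplyData.toLineSupplyData⟩)
    gen12 real34 occ

end Model

end HodgeCM

end
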